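import Mathlib
import HarnessLib

/-!
# The flag hypotheses of a blow-up step from generators of the centre (crux `WildQuotients.WildQuotientResolution`, Phase 0)

Crux stmt-ResolutionOfSingularities-15640 (`WildQuotientResolution`), line `Sketch` (card
`p-closure-sylow-separation`), registered stub `stub_phaseZeroHighDim`. The one-step engine
`FlagCore.stub_flagCore` / its scheme form `CentreBlowupInertia.hasNormalSylow_inertia_of_centreBlowup`
(`Theorems/…CentreBlowupInertia.lean`) asks of the centre stalk `J ≤ 𝔪` three linear-algebra
conditions on `V = 𝔪/𝔪²`: `J ∩ 𝔪² ⊆ 𝔪 J`, `J̄` spanned by two elements of `J`, and `V = J̄ + κ v̄₀`.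
This Mathlib-only file discharges them from GENERATORS, the form in which a regular curve on a
regular threefold presents its ideal at a point (`J = (j₁, j₂)`, `𝔪 = (v₀, j₁, j₂)` with `j̄₁, j̄₂`
linearly independent in `𝔪/𝔪²` — two of three regular parameters):

* `inf_sq_le_mul_of_span_pair` — if `J = (j₁, j₂)` and `a j₁ + b j₂ ∈ 𝔪²` forces `a, b ∈ 𝔪`, then
  `J ∩ 𝔪² ⊆ 𝔪 J`.
* `flagCore_data_of_generators` — all four hypotheses (`J ≤ 𝔪` included) at once.

[OURS · crux stmt-ResolutionOfSingularities-15640 · helper toward `stub_phaseZeroHighDim`; folklore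
linear algebra, counted 0; AI-level work, weaker than expert review.]
-/

-- single-problem summit: the doubled namespace component `ResolutionOfSingularities` is forced
set_option linter.dupNamespace false

open IsLocalRing

namespace Summit.ResolutionOfSingularities.ResolutionOfSingularities.Theorems.WildQuotientResolution.CentreGenerators

variable {R : Type*} [CommRing R] [IsLocalRing R]

/-- **`J ∩ 𝔪² ⊆ 𝔪 J` for an ideal generated by elements independent modulo `𝔪²`**: if
`J = (j₁, j₂)` and `a j₁ + b j₂ ∈ 𝔪²` only when `a, b ∈ 𝔪` (the classes `j̄₁, j̄₂ ∈ 𝔪/𝔪²` are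
linearly independent), then every element of `J` lying in `𝔪²` lies in `𝔪 J`. [folklore] -/
theorem inf_sq_le_mul_of_span_pair {J : Ideal R} {j₁ j₂ : R} (hJ : J = Ideal.span {j₁, j₂})
    (hind : ∀ a b : R, a * j₁ + b * j₂ ∈ maximalIdeal R ^ 2 →
      a ∈ maximalIdeal R ∧ b ∈ maximalIdeal R) :
    J ⊓ maximalIdeal R ^ 2 ≤ maximalIdeal R * J := by
  intro j hj
  rw [Submodule.mem_inf] at hj
  obtain ⟨hjJ, hj2⟩ := hj
  have hj₁ : j₁ ∈ J := hJ ▸ Ideal.subset_span (Set.mem_insert _ _)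
  have hj₂ : j₂ ∈ J := hJ ▸ Ideal.subset_span (Set.mem_insert_of_mem _ rfl)
  rw [hJ, Ideal.mem_span_pair] at hjJ
  obtain ⟨a, b, rfl⟩ := hjJ
  obtain ⟨ha, hb⟩ := hind a b hj2
  exact add_mem (Ideal.mul_mem_mul ha hj₁) (Ideal.mul_mem_mul hb hj₂)

/-- **The flag hypotheses of `FlagCore.stub_flagCore` from generators.** In a local ring
`(R, 𝔪)` let `J = (j₁, j₂)` and `𝔪 = (v₀, j₁, j₂)` with `j̄₁, j̄₂` linearly independent in `𝔪/𝔪²`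
(`a j₁ + b j₂ ∈ 𝔪² ⟹ a, b ∈ 𝔪`). Then `J ≤ 𝔪`, `J ∩ 𝔪² ⊆ 𝔪 J`, `J̄` is spanned by the classes of
two elements of `J`, and `𝔪 = J + R v₀` modulo `𝔪²` — verbatim the hypotheses `hJm`, `hJ2`,
`hJgen`, `hVgen` of `FlagCore.stub_flagCore` and of
`CentreBlowupInertia.hasNormalSylow_inertia_of_centreBlowup`. [folklore] -/
theorem flagCore_data_of_generators {J : Ideal R} {j₁ j₂ v₀ : R} (hJ : J = Ideal.span {j₁, j₂})
    (hm : maximalIdeal R = Ideal.span {v₀, j₁, j₂})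
    (hind : ∀ a b : R, a * j₁ + b * j₂ ∈ maximalIdeal R ^ 2 →
      a ∈ maximalIdeal R ∧ b ∈ maximalIdeal R) :
    J ≤ maximalIdeal R ∧
      J ⊓ maximalIdeal R ^ 2 ≤ maximalIdeal R * J ∧
      (∃ j₁' ∈ J, ∃ j₂' ∈ J, ∀ j ∈ J, ∃ a b : R,
        j - (a * j₁' + b * j₂') ∈ maximalIdeal R ^ 2) ∧
      (∃ v ∈ maximalIdeal R, ∀ r ∈ maximalIdeal R, ∃ a : R, ∃ j ∈ J,
        r - (a * v + j) ∈ maximalIdeal R ^ 2) := by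
  have hj₁ : j₁ ∈ J := hJ ▸ Ideal.subset_span (Set.mem_insert _ _)
  have hj₂ : j₂ ∈ J := hJ ▸ Ideal.subset_span (Set.mem_insert_of_mem _ rfl)
  have hJm : J ≤ maximalIdeal R := by
    rw [hJ, hm, Ideal.span_le]
    intro y hy
    rcases hy with rfl | rfl
    · exact Ideal.subset_span (Set.mem_insert_of_mem _ (Set.mem_insert _ _))
    · exact Ideal.subset_span (Set.mem_insert_of_mem _ (Set.mem_insert_of_mem _ rfl))
  refine ⟨hJm, inf_sq_le_mul_of_span_pair hJ hind, ⟨j₁, hj₁, j₂, hj₂, fun j hj => ?_⟩,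
    ⟨v₀, hm ▸ Ideal.subset_span (Set.mem_insert _ _), fun r hr => ?_⟩⟩
  · rw [hJ, Ideal.mem_span_pair] at hj
    obtain ⟨a, b, rfl⟩ := hj
    exact ⟨a, b, by rw [sub_self]; exact zero_mem _⟩
  · rw [hm, Ideal.mem_span_insert] at hr
    obtain ⟨a, z, hz, rfl⟩ := hr
    exact ⟨a, z, hJ ▸ hz, by rw [sub_self]; exact zero_mem _⟩

end Summit.ResolutionOfSingularities.ResolutionOfSingularities.Theorems.WildQuotientResolution.CentreGenerators
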